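import Mathlib
import HarnessLib
import Summits.NavierStokesRegularity.NavierStokesRegularity.Theorems.PoloidalWindowDoorLrcModEntireJetCertPsatz

/-!
# Jet-certificate checker — TABLES of point-level rows and WITNESS rows (exact rational points) over the Positivstellensatz leaf

Cell pub-ns-dss, seat ns-crc-p1 gen 5 (Lean-certificate hand of the wall experiment `ns-wall-extremal`, arm C; DIRECTOR-NS dss_99 (2) / req171 (3)), 2026-08-28.
`--supports stmt-NavierStokesRegularity-19708` (walls W4 / W3 as an instrument).  Generic; no Navier–Stokes content.  Companion of `…JetCertPsatz`
(`PsatzLeaf`, `pointCheckP`, `PointDatum`, `not_pointDatum_of_pointCheckP`): this file is what an arm-C TABLE (format note `ARM-C-TABLE-FORMAT.md`, evidence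
on items 19708 / 26991) compiles to.

* point-level certificate TREES `PTree` (Positivstellensatz `leaf`; `chunk` = adjoin a law `T ≡ Σ cᵢ law_{kᵢ}`, Boolean `combCheck`, `PointDatum.extend`; `split` on a
  polynomial `π`, `PointDatum.split`) — the shape of a greedy exact elimination with branching — with `ptreeCheck` and **`not_pointDatum_of_ptreeCheck`**;
* `Row` (label, hyps, pins, zs, nonneg, cert : PTree), the Boolean `tableCheckP n rows` and **`tableCheckP_sound`**: in a checked table every row's semi-algebraic
  jet set `{hyps = 0, pins ≠ 0, gauge letters = 0, nonneg ≥ 0}` has NO real point («EMPTY at its truncation level»);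
* WITNESS rows (the falsifier direction): `evalQ`, `ptOfList`, `ev_ptOfList`, the Boolean `witnessCheck n hyps pins zs nonneg x` (`x : List ℚ`) and
  **`pointDatum_of_witnessCheck`** — an exact rational jet passing every law / pin / gauge / sign test IS a point datum; `witness_excludes_certificate`
  (no row is both EMPTY and WITNESSED).
A generated data module (`armc2lean.py`, HOME pub-ns-dss/wall-extremal/arm-C/) is `def row_i : Row := …`, `def tableRows`, `theorem table_ok : tableCheckP n
tableRows = true := by native_decide` (computational lane) and the by-name corollaries `row_i_empty` / `row_j_witness`.

WHAT THIS IS NOT: not a claim about Navier–Stokes, not a certificate — table plumbing and its soundness. [folklore]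
-/

noncomputable section

-- the summit and its single sub-problem share the name (CONVENTIONS §1), as in every Theorems file
set_option linter.dupNamespace false

namespace Summit.NavierStokesRegularity.NavierStokesRegularity.Theorems.PoloidalWindowDoorLrcModEntireJetCertPsatzTable

open _root_.Topology _root_.Filter Set
open Literature.Analysis.ValidatedNumerics Literature.Analysis.ValidatedNumerics.QMvPoly
open Literature.Analysis.Calculus.MvPoly
open Summit.NavierStokesRegularity.NavierStokesRegularity.Theorems.PoloidalWindowDoorLrcModEntireJetCertDefs
open Summit.NavierStokesRegularity.NavierStokesRegularity.Theorems.PoloidalWindowDoorLrcModEntireJetCertTree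
open Summit.NavierStokesRegularity.NavierStokesRegularity.Theorems.PoloidalWindowDoorLrcModEntireJetCertFast2
open Summit.NavierStokesRegularity.NavierStokesRegularity.Theorems.PoloidalWindowDoorLrcModEntireJetCertGauge
open Summit.NavierStokesRegularity.NavierStokesRegularity.Theorems.PoloidalWindowDoorLrcModEntireJetCertPsatz

variable {n : ℕ}

/-! ### Point-level certificate TREES: Positivstellensatz leaves, chunks (new laws as combinations), splits (case `π = 0` / `π ≠ 0`) -/

/-- **POINT-LEVEL CHUNK CHECK** (Boolean): `T ≡ Σᵢ cᵢ · law_{kᵢ}` syntactically (trimmed, normalised) — `T` may join the laws. [folklore] -/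
def combCheck (hyps : List QMvPoly) (comb : List (QMvPoly × ℕ)) (T : QMvPoly) : Bool :=
  decide (normalizeS (trimQ (idealComb hyps comb ++ QMvPoly.smul (-1) T)) = [])

/-- A checked combination of the laws vanishes at every point datum, so it may be adjoined. [folklore] -/
theorem PointDatum.extend {hyps pins : List QMvPoly} {zs : List ℕ} {nonneg : List QMvPoly} {comb : List (QMvPoly × ℕ)} {T : QMvPoly}
    (h : PointDatum n hyps pins zs nonneg) (hc : combCheck hyps comb T = true) : PointDatum n (hyps ++ [T]) pins zs nonneg := by
  obtain ⟨z, hh, hp, hz, hq⟩ := h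
  refine ⟨z, ?_, hp, hz, hq⟩
  intro L hL
  rcases List.mem_append.1 hL with hL' | hL'
  · exact hh L hL'
  · rw [List.mem_singleton.1 hL']
    simp only [combCheck, decide_eq_true_eq] at hc
    have h0 : ev n (normalizeS (trimQ (idealComb hyps comb ++ QMvPoly.smul (-1) T))) z = 0 := by rw [hc, ev_nil]
    rw [ev_normalizeS, ev_trimQ, ev_append, ev_smul, ev_idealComb_eq_zero z hyps hh] at h0
    have : ((-1 : ℚ) : ℝ) * ev n T z = 0 := by simpa using h0
    simpa using this

/-- Case split at a point: either `π(z) ≠ 0` (it becomes a pin) or `π(z) = 0` (it becomes a law). [folklore] -/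
theorem PointDatum.split {hyps pins : List QMvPoly} {zs : List ℕ} {nonneg : List QMvPoly} (π : QMvPoly)
    (h : PointDatum n hyps pins zs nonneg) : PointDatum n hyps (pins ++ [π]) zs nonneg ∨ PointDatum n (hyps ++ [π]) pins zs nonneg := by
  obtain ⟨z, hh, hp, hz, hq⟩ := h
  by_cases hπ : ev n π z = 0
  · refine Or.inr ⟨z, ?_, hp, hz, hq⟩
    intro L hL
    rcases List.mem_append.1 hL with hL' | hL'
    · exact hh L hL'
    · rw [List.mem_singleton.1 hL']; exact hπ
  · refine Or.inl ⟨z, hh, ?_, hz, hq⟩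
    intro π' hπ'
    rcases List.mem_append.1 hπ' with h' | h'
    · exact hp π' h'
    · rw [List.mem_singleton.1 h']; exact hπ

/-- **A POINT-LEVEL CERTIFICATE TREE**: `leaf c` closes the node by the Positivstellensatz leaf `c`; `chunk comb T t` adjoins the law `T ≡ Σ cᵢ law_{kᵢ}` and continues
with `t`; `split π nz z` branches on `π` (branch `nz`: `π` joins the pins; branch `z`: `π` joins the laws).  This is the shape of a greedy exact elimination with branching
(pivot = chunk, «coefficient forced to vanish unless …» = split, terminal one-monomial identity = leaf). [folklore] -/
inductive PTree : Type
  | leaf : PsatzLeaf → PTree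
  | chunk : List (QMvPoly × ℕ) → QMvPoly → PTree → PTree
  | split : QMvPoly → PTree → PTree → PTree

/-- **THE TREE CHECK** (Boolean, structural recursion). [folklore] -/
def ptreeCheck (n : ℕ) : List QMvPoly → List QMvPoly → List ℕ → List QMvPoly → PTree → Bool
  | hyps, pins, zs, nonneg, .leaf c => pointCheckP n hyps pins zs nonneg c
  | hyps, pins, zs, nonneg, .chunk comb T t => combCheck hyps comb T && ptreeCheck n (hyps ++ [T]) pins zs nonneg t
  | hyps, pins, zs, nonneg, .split π nz z => ptreeCheck n hyps (pins ++ [π]) zs nonneg nz && ptreeCheck n (hyps ++ [π]) pins zs nonneg z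

/-- **SOUNDNESS OF POINT-LEVEL TREES**: a checked tree proves that the semi-algebraic set has no real point. [folklore] -/
theorem not_pointDatum_of_ptreeCheck : ∀ (t : PTree) {hyps pins : List QMvPoly} {zs : List ℕ} {nonneg : List QMvPoly},
    ptreeCheck n hyps pins zs nonneg t = true → ¬ PointDatum n hyps pins zs nonneg := by
  intro t
  induction t with
  | leaf c => intro hyps pins zs nonneg h; exact not_pointDatum_of_pointCheckP h
  | chunk comb T t ih =>
    intro hyps pins zs nonneg h hd
    simp only [ptreeCheck, Bool.and_eq_true] at h
    exact ih h.2 (PointDatum.extend hd h.1)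
  | split π nz z ihnz ihz =>
    intro hyps pins zs nonneg h hd
    simp only [ptreeCheck, Bool.and_eq_true] at h
    rcases PointDatum.split π hd with h' | h'
    · exact ihnz h.1 h'
    · exact ihz h.2 h'

/-! ### Tables of rows -/

/-- **A ROW** of an exclusion table over a fixed dictionary of `n` letters: the stratum's laws (class equations prolonged to the row's truncation level),
its pins (non-degeneracy: «non-trivial candidate»), gauge letters, sign constraints, and the row's certificate tree. [folklore] -/
structure Row where
  /-- free-text label (stratum, truncation level) — not read by the checker -/
  label : String
  /-- laws `= 0` -/
  hyps : List QMvPoly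
  /-- pins `≠ 0` -/
  pins : List QMvPoly
  /-- gauge letters `= 0` (indices) -/
  zs : List ℕ
  /-- sign constraints `≥ 0` -/
  nonneg : List QMvPoly
  /-- the certificate tree of the row (a single Positivstellensatz leaf is `.leaf c`) -/
  cert : PTree

/-- **THE TABLE CHECK** (Boolean): every row's certificate tree passes. [folklore] -/
def tableCheckP (n : ℕ) (rows : List Row) : Bool :=
  rows.all fun r => ptreeCheck n r.hyps r.pins r.zs r.nonneg r.cert

/-- **SOUNDNESS OF TABLES**: in a checked table no row has a real point — each row is EMPTY at its truncation level. [folklore] -/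
theorem tableCheckP_sound {rows : List Row} (h : tableCheckP n rows = true) :
    ∀ r ∈ rows, ¬ PointDatum n r.hyps r.pins r.zs r.nonneg := by
  simp only [tableCheckP, List.all_eq_true] at h
  exact fun r hr => not_pointDatum_of_ptreeCheck r.cert (h r hr)

/-! ### Witness rows: exact rational points -/

/-- Exact rational evaluation of a term list at the point with coordinates `x.getD i 0`, `i < n`. [folklore] -/
def evalQ (n : ℕ) (x : List ℚ) (p : QMvPoly) : ℚ :=
  (p.map fun t => t.2 * ∏ i : Fin n, x.getD i 0 ^ t.1.getD i 0).sum

/-- The real point with rational coordinates `x.getD i 0`. [folklore] -/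
def ptOfList (n : ℕ) (x : List ℚ) : EuclideanSpace ℝ (Fin n) :=
  WithLp.toLp 2 fun i => ((x.getD i 0 : ℚ) : ℝ)

/-- Coordinates of `ptOfList`. [folklore] -/
@[simp] theorem ptOfList_apply (x : List ℚ) (i : Fin n) : ptOfList n x i = ((x.getD i 0 : ℚ) : ℝ) := rfl

/-- `ev` at a rational point is the cast of the exact rational value. [folklore] -/
theorem ev_ptOfList (x : List ℚ) : ∀ p : QMvPoly, ev n p (ptOfList n x) = ((evalQ n x p : ℚ) : ℝ) := by
  intro p
  induction p with
  | nil => simp [evalQ]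
  | cons t q ih =>
    rw [ev, toFun_apply, QMvPoly.eval_toMv_cons, ← toFun_apply, ← ev, ih]
    simp only [evalQ, List.map_cons, List.sum_cons, ptOfList_apply]
    push_cast
    ring

/-- **THE WITNESS CHECK** (Boolean): at the rational point `x` every law evaluates to `0`, every pin to a non-zero value, every gauge letter (of index
`< n`) is `0`, every sign constraint is `≥ 0` — all in exact rational arithmetic. [folklore] -/
def witnessCheck (n : ℕ) (hyps pins : List QMvPoly) (zs : List ℕ) (nonneg : List QMvPoly) (x : List ℚ) : Bool :=
  (hyps.all fun L => decide (evalQ n x L = 0)) && (pins.all fun π => !decide (evalQ n x π = 0)) &&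
    (zs.all fun i => decide (n ≤ i) || decide (x.getD i 0 = 0)) && (nonneg.all fun q => decide (0 ≤ evalQ n x q))

/-- **A CHECKED WITNESS IS A POINT DATUM** (the falsifier direction of a table row: an exact candidate jet). [folklore] -/
theorem pointDatum_of_witnessCheck {hyps pins : List QMvPoly} {zs : List ℕ} {nonneg : List QMvPoly} {x : List ℚ}
    (h : witnessCheck n hyps pins zs nonneg x = true) : PointDatum n hyps pins zs nonneg := by
  simp only [witnessCheck, Bool.and_eq_true, List.all_eq_true, decide_eq_true_eq, Bool.or_eq_true, Bool.not_eq_true',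
    decide_eq_false_iff_not] at h
  obtain ⟨⟨⟨hh, hp⟩, hz⟩, hq⟩ := h
  refine ⟨ptOfList n x, ?_, ?_, ?_, ?_⟩
  · intro L hL
    rw [ev_ptOfList, hh L hL]; simp
  · intro π hπ
    rw [ev_ptOfList]; exact_mod_cast hp π hπ
  · intro i hi hin
    rcases hz i hi with h | h
    · exact absurd hin (not_lt.2 h)
    · show (((x.getD i 0 : ℚ)) : ℝ) = 0
      rw [h]; simp
  · intro q hq'
    rw [ev_ptOfList]; exact_mod_cast hq q hq'

/-- **NO ROW IS BOTH EMPTY AND WITNESSED**: a point-level certificate and a rational witness for the same row cannot both check. [folklore] -/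
theorem witness_excludes_certificate {hyps pins : List QMvPoly} {zs : List ℕ} {nonneg : List QMvPoly} {x : List ℚ} {c : PsatzLeaf}
    (hw : witnessCheck n hyps pins zs nonneg x = true) (hc : pointCheckP n hyps pins zs nonneg c = true) : False :=
  not_pointDatum_of_pointCheckP hc (pointDatum_of_witnessCheck hw)

/-! ### Self-test (`decide +kernel`)

Two letters `X₀ = a`, `X₁ = b`: the set `{a − b² = 0, b ≠ 0, a ≥ 0}` has the rational point `(4, 2)`. -/

/-- Self-test (2): the witness `(4, 2)` checks (`decide +kernel`), hence that set is NOT empty. [folklore] -/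
theorem example_witness :
    PointDatum 2 [QMvPoly.var 2 0 ++ QMvPoly.smul (-1) (QMvPoly.mul (QMvPoly.var 2 1) (QMvPoly.var 2 1))] [QMvPoly.var 2 1] []
      [QMvPoly.var 2 0] :=
  pointDatum_of_witnessCheck (x := [4, 2]) (by decide +kernel)

end Summit.NavierStokesRegularity.NavierStokesRegularity.Theorems.PoloidalWindowDoorLrcModEntireJetCertPsatzTable

end
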